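import Summits.NavierStokesRegularity.NavierStokesRegularity.Theses.TypeIQuarterGate
import Summits.NavierStokesRegularity.NavierStokesRegularity.Theorems.TypeIQuarterGateQuarterLawTypeIOneScaleSmallnessScale
import Summits.NavierStokesRegularity.NavierStokesRegularity.Theorems.TypeIQuarterGateLorentzBoundEventual
import Summits.NavierStokesRegularity.NavierStokesRegularity.Theorems.TypeIQuarterGateQuarterLawTypeIStubCountQuarterLaw
import Summits.NavierStokesRegularity.NavierStokesRegularity.Theorems.TypeIQuarterGateQuarterLawTypeIIffUniformCount
import HarnessLib

/-!
# `TypeIQuarterGate`: the uniform concentration count gives the Lorentz bound —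
# `LorentzUpgradeTypeI ⟺ QuarterLawTypeI` (the registered line is at its fixed point)

Crux `QuarterLawTypeI` (stmt-NavierStokesRegularity-23726), registered line `lorentz-upgrade`
(`stub_lorentzUpgrade` = item 24108 OPEN; `stub_lorentzCount` p816300; `stub_countQuarterLaw` p815836).
The tree already has `24108 ⟹ 23970 ⟹ 23726 ⟺ 23970`.  THIS FILE proves the missing converse
**`UniformConcentrationCountTypeI ⟹ LorentzUpgradeTypeI`** (23970 ⟹ 24108), hence

  `LorentzUpgradeTypeI ⟺ UniformConcentrationCountTypeI ⟺ QuarterLawTypeI`   (kernel, unconditional):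

the open stub of the registered skeleton is EQUIVALENT to the crux it was meant to feed — the line
`lorentz-upgrade` is at its FIXED POINT (compare `GaldiLiouvilleGate`'s `parabolicGaldiLiouville_iff_sharpTwoGate`).

PROOF of `23970 ⟹ 24108` (ε-regularity covering; Choe–Wolf–Yang / Barker's mechanism run backwards):
fix a late time `t`, `s = √(T−t)`, and a level `σ`.
* FREE-SCALE ONE-SCALE SMALLNESS (`LorentzOfEnvelope.oneScaleSmallness_scale`, p818404): there are
  `η, ϑ', λ, r₀` with: for every radius `r ∈ [λ s, r₀]`, if `‖u(t,x)‖ > ϑ'/r` then the vertex-`T` cylinder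
  `B_r(x) × (T − r², T)` is `η`-concentrating (`∫∫|∇u|² ≥ η r`).
* So at the level `σ = ϑ'/r` every point of the superlevel set `S_σ(t) = {σ < ‖u(t)‖}` centres an
  `η`-concentrating `r`-cylinder, and the COUNT (23970 at threshold `η`) bounds every `2r`-separated finite
  subset of `S_σ(t)` by `N`; a maximal separated subset then covers: `|S_σ(t)| ≤ N |B(0,2r)|`
  (`volume_le_of_separated_card_le`), i.e. `σ³|S_σ(t)| ≤ 8 N ϑ'³ |B(0,1)|` for `ϑ'/r₀ < σ ≤ ϑ'/(λ s)`.
* Low levels `σ ≤ ϑ'/r₀`: Chebyshev with the energy, `σ³|S_σ| ≤ σ·2E(u₀) ≤ 2E(u₀)ϑ'/r₀`.  High levels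
  `ϑ'/(λs) < σ < C/s` (the Type-I rate empties `S_σ` beyond `C/s`): monotonicity in the level,
  `σ³|S_σ| ≤ (C/s)³ |S_{ϑ'/(λs)}| ≤ 8 N λ³ C³ |B(0,1)|`.
* Early times are free (`LorentzOfEnvelope.lorentzBound_of_eventually`, p817829).

HONEST FRAMING: an equivalence between OPEN statements along a HYPOTHETICAL Type-I blow-up; none of
23726 / 23970 / 24108 is proved; nothing about Navier–Stokes regularity or blow-up is claimed.
[cite: CaffarelliKohnNirenberg1982, Proposition 1] [cite: Seregin2014, Ch. 6 §6.3 Prop. 3.11 (i)]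
-/

-- the problem directory repeats the summit name (`NavierStokesRegularity/NavierStokesRegularity`)
set_option linter.dupNamespace false

noncomputable section

open Set Filter MeasureTheory Topology Metric
open scoped ENNReal NNReal

namespace Summit.NavierStokesRegularity.NavierStokesRegularity.Theorems

namespace LorentzOfEnvelope

open Literature.Analysis.FluidPDE Literature.Analysis.FunctionSpaces

/-! ### Covering: a set whose separated finite subsets are bounded in number has bounded volume -/

/-- **Packing ⟹ covering.** If every `2r`-separated finite subset of `S ⊆ ℝ³` has at most `N` points
(`r > 0`), then `|S| ≤ N · (2r)³ · |B(0,1)|`: a separated subset of maximal cardinality is a `2r`-net of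
`S`. [folklore] -/
theorem volume_le_of_separated_card_le {S : Set (EuclideanSpace ℝ (Fin 3))} {r : ℝ} (hr : 0 < r)
    {N : ℕ}
    (h : ∀ σ : Finset (EuclideanSpace ℝ (Fin 3)), (↑σ : Set (EuclideanSpace ℝ (Fin 3))) ⊆ S →
      (∀ x ∈ σ, ∀ x' ∈ σ, x ≠ x' → 2 * r ≤ ‖x - x'‖) → σ.card ≤ N) :
    volume S ≤ ENNReal.ofReal (N * (2 * r) ^ 3) * volume (ball (0 : EuclideanSpace ℝ (Fin 3)) 1) := by
  classical
  -- separated finite subsets of `S` with prescribed cardinality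
  set P : ℕ → Prop := fun k => ∃ σ : Finset (EuclideanSpace ℝ (Fin 3)),
    (↑σ : Set (EuclideanSpace ℝ (Fin 3))) ⊆ S ∧
      (∀ x ∈ σ, ∀ x' ∈ σ, x ≠ x' → 2 * r ≤ ‖x - x'‖) ∧ σ.card = k with hP_def
  have hP0 : P 0 := ⟨∅, by simp, by simp, rfl⟩
  set m : ℕ := Nat.findGreatest P N with hm_def
  obtain ⟨σ, hσS, hσsep, hσcard⟩ : P m := Nat.findGreatest_spec (Nat.zero_le N) hP0
  have hmN : m ≤ N := Nat.findGreatest_le N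
  -- maximality: `S ⊆ ⋃_{x ∈ σ} B(x, 2r)`
  have hcover : S ⊆ ⋃ x ∈ σ, ball x (2 * r) := by
    intro y hy
    by_contra hfar
    simp only [mem_iUnion, mem_ball, exists_prop, not_exists, not_and, not_lt] at hfar
    -- `hfar : ∀ x ∈ σ, 2r ≤ dist y x`
    have hyσ : y ∉ σ := fun hyσ => by
      have := hfar y hyσ
      rw [dist_self] at this
      linarith
    have hP' : P (m + 1) := by
      refine ⟨insert y σ, ?_, ?_, by rw [Finset.card_insert_of_notMem hyσ, hσcard]⟩
      · rw [Finset.coe_insert]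
        exact insert_subset hy hσS
      · intro x hx x' hx' hne
        rw [Finset.mem_insert] at hx hx'
        rcases hx with rfl | hx
        · rcases hx' with rfl | hx'
          · exact absurd rfl hne
          · have := hfar x' hx'; rwa [dist_eq_norm] at this
        · rcases hx' with rfl | hx'
          · have := hfar x hx; rwa [dist_eq_norm, norm_sub_rev] at this
          · exact hσsep x hx x' hx' hne
    -- `m + 1 ≤ N` (by `h`) contradicts the maximality of `m`
    obtain ⟨σ', hσ'S, hσ'sep, hσ'card⟩ := hP'
    have hle : m + 1 ≤ N := hσ'card ▸ h σ' hσ'S hσ'sep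
    exact Nat.findGreatest_is_greatest (Nat.lt_succ_self m) hle ⟨σ', hσ'S, hσ'sep, hσ'card⟩
  -- volume
  have hr2 : 0 ≤ 2 * r := by linarith
  calc volume S ≤ volume (⋃ x ∈ σ, ball x (2 * r)) := measure_mono hcover
    _ ≤ ∑ x ∈ σ, volume (ball x (2 * r)) := measure_biUnion_finset_le σ _
    _ = ∑ x ∈ σ, ENNReal.ofReal ((2 * r) ^ 3) * volume (ball (0 : EuclideanSpace ℝ (Fin 3)) 1) := by
        refine Finset.sum_congr rfl fun x _ => ?_
        rw [Measure.addHaar_ball volume x hr2, finrank_euclideanSpace_fin]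
    _ = ENNReal.ofReal (σ.card * (2 * r) ^ 3) * volume (ball (0 : EuclideanSpace ℝ (Fin 3)) 1) := by
        rw [Finset.sum_const, nsmul_eq_mul, ENNReal.ofReal_mul (Nat.cast_nonneg _),
          ENNReal.ofReal_natCast, mul_assoc]
    _ ≤ ENNReal.ofReal (N * (2 * r) ^ 3) * volume (ball (0 : EuclideanSpace ℝ (Fin 3)) 1) := by
        gcongr
        exact_mod_cast hσcard ▸ hmN

/-! ### The count gives the Lorentz bound -/

/-- **Uniform concentration count ⟹ uniform weak-`L³` bound**, along one solution: for a classical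
solution on `[0,T)` (`ν > 0`), Leray–Hopf from its rapidly decaying datum, with the sup-norm Type-I rate
at `T`, the scale-uniform `ε`-concentration count (the conclusion of `UniformConcentrationCountTypeI`)
implies `sup_{t<T} sup_σ σ³|{σ < ‖u(t)‖}| < ∞` (the conclusion of `LorentzUpgradeTypeI`).
[cite: CaffarelliKohnNirenberg1982, Proposition 1] [cite: Seregin2014, Ch. 6 §6.3 Prop. 3.11 (i)] -/
theorem lorentzBound_of_count {ν T : ℝ} (hν : 0 < ν) (hT : 0 < T)
    {u : ℝ → EuclideanSpace ℝ (Fin 3) → EuclideanSpace ℝ (Fin 3)}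
    {p : ℝ → EuclideanSpace ℝ (Fin 3) → ℝ}
    (hsol : IsClassicalNSSolutionOn (Ico 0 T) ν 0 u p) (hLH : IsLerayHopfOn T ν 0 (u 0) u)
    (hdec : HasRapidSpatialDecay (u 0)) (hI : IsTypeIBlowup u T)
    (hcount : ∀ η : ℝ, 0 < η → ∃ N : ℕ, ∃ r₀ : ℝ, 0 < r₀ ∧ ∀ r : ℝ, 0 < r → r ≤ r₀ →
      ∀ σ : Finset (EuclideanSpace ℝ (Fin 3)),
        (∀ x ∈ σ, ∀ x' ∈ σ, x ≠ x' → 2 * r ≤ ‖x - x'‖) →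
        (∀ x ∈ σ, ENNReal.ofReal (η * r) ≤ ∫⁻ s in Ioo (T - r ^ 2) T, ∫⁻ y in ball x r,
          ENNReal.ofReal (frobeniusNormSq (fderiv ℝ (u s) y))) → σ.card ≤ N) :
    ∃ M' : ℝ, ∀ t ∈ Ico 0 T, eWeakLpPow (u t) 3 volume ≤ ENNReal.ofReal M' := by
  -- the inputs
  obtain ⟨η, ϑ', lam, r₀, t₁, hη, hϑ', hlam, hr₀, ht₁T, hS⟩ :=
    oneScaleSmallness_scale hν hT hsol hLH hI
  obtain ⟨N, r₂, hr₂, hN⟩ := hcount η hη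
  obtain ⟨CI, hCI⟩ := hI
  obtain ⟨t₂, ht₂T, hrate⟩ := mem_nhdsLT_iff_exists_Ioo_subset.1 hCI
  set B : ℝ := max CI 0 with hB_def
  have hB0 : 0 ≤ B := le_max_right _ _
  set R : ℝ := min r₀ r₂ with hR_def
  have hR : 0 < R := lt_min hr₀ hr₂
  have hRr₀ : R ≤ r₀ := min_le_left _ _
  have hRr₂ : R ≤ r₂ := min_le_right _ _
  set E : ℝ := 2 * VectorCalculus.kineticEnergy (u 0) with hE_def
  have hE0 : 0 ≤ E := by rw [hE_def]; exact mul_nonneg zero_le_two (kineticEnergy_nonneg _)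
  set V : ℝ≥0∞ := volume (ball (0 : EuclideanSpace ℝ (Fin 3)) 1) with hV_def
  have hVtop : V ≠ ⊤ := measure_ball_lt_top.ne
  -- the late window
  set t₀ : ℝ := max (max t₁ t₂) (max 0 (T - (R / lam) ^ 2)) with ht₀_def
  have ht₀T : t₀ < T := by
    refine max_lt (max_lt ht₁T ht₂T) (max_lt hT ?_)
    have : 0 < (R / lam) ^ 2 := by positivity
    linarith
  -- the bound
  set Mtot : ℝ≥0∞ := ENNReal.ofReal (ϑ' / R * E) +
    (ENNReal.ofReal (8 * N * ϑ' ^ 3) * V + ENNReal.ofReal (8 * N * (lam * B) ^ 3) * V) with hMtot_def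
  have hMtop : Mtot ≠ ⊤ :=
    ENNReal.add_ne_top.2 ⟨ENNReal.ofReal_ne_top, ENNReal.add_ne_top.2
      ⟨ENNReal.mul_ne_top ENNReal.ofReal_ne_top hVtop, ENNReal.mul_ne_top ENNReal.ofReal_ne_top hVtop⟩⟩
  refine lorentzBound_of_eventually hν hT hsol hLH hdec ⟨Mtot.toReal, (t₀ + T) / 2, by linarith, ?_⟩
  intro t ht
  rw [ENNReal.ofReal_toReal hMtop]
  -- facts at time `t`
  have htt₀ : t₀ < t := by linarith [ht.1]
  have htT : t < T := ht.2
  have ht₁ : t₁ < t := lt_of_le_of_lt ((le_max_left _ _).trans (le_max_left _ _)) htt₀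
  have ht₂ : t₂ < t := lt_of_le_of_lt ((le_max_right _ _).trans (le_max_left _ _)) htt₀
  have ht0 : 0 ≤ t := ((le_max_left _ _).trans (le_max_right _ _)).trans htt₀.le
  have hTt : 0 < T - t := sub_pos.2 htT
  set s : ℝ := Real.sqrt (T - t) with hs_def
  have hs : 0 < s := Real.sqrt_pos.2 hTt
  have hs2 : s ^ 2 = T - t := Real.sq_sqrt hTt.le
  have hls : lam * s < R := by
    have h1 : T - (R / lam) ^ 2 < t := lt_of_le_of_lt ((le_max_right _ _).trans (le_max_right _ _)) htt₀
    have h2 : s ^ 2 < (R / lam) ^ 2 := by rw [hs2]; linarith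
    have h3 : s < R / lam := lt_of_pow_lt_pow_left₀ 2 (by positivity) h2
    have := mul_lt_mul_of_pos_left h3 hlam
    rwa [mul_div_cancel₀ _ hlam.ne'] at this
  have hrate_t : ∀ x, ‖u t x‖ ≤ B / s := fun x =>
    (hrate ⟨ht₂, htT⟩ x).trans (div_le_div_of_nonneg_right (le_max_left _ _) hs.le)
  have hmem : MemLp (u t) 2 volume := hLH.memLp t ⟨ht0, htT.le⟩
  have hEt : ∫⁻ x, ‖u t x‖ₑ ^ 2 ≤ ENNReal.ofReal E :=
    lintegral_sq_le_of_isLerayHopfOn hν.le hLH ⟨ht0, htT.le⟩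
  -- KEY CLAIM: at scales `r ∈ [λ s, R]` the superlevel set at `ϑ'/r` is covered by `N` balls `B(·,2r)`
  have hKC : ∀ r : ℝ, lam * s ≤ r → r ≤ R →
      volume {x | ϑ' / r < ‖u t x‖} ≤ ENNReal.ofReal (N * (2 * r) ^ 3) * V := by
    intro r hr1 hr2
    have hrpos : 0 < r := lt_of_lt_of_le (mul_pos hlam hs) hr1
    refine volume_le_of_separated_card_le hrpos fun σ hσS hσsep => ?_
    refine hN r hrpos (hr2.trans hRr₂) σ hσsep fun x hx => ?_
    -- each point of the superlevel set centres a concentrating cylinder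
    by_contra hnc
    have hsmall := hS t ⟨ht₁, htT⟩ x r hr1 (hr2.trans hRr₀) hnc
    have hbig : ϑ' / r < ‖u t x‖ := hσS hx
    linarith
  -- level-by-level
  have h3 : (0 : ℝ) < (3 : ℝ≥0∞).toReal := by norm_num
  refine Wu2026Salvage.eWeakLpPow_le_of_forall h3 fun σ hσ => ?_
  have e3 : ENNReal.ofReal (σ ^ (3 : ℝ≥0∞).toReal) = ENNReal.ofReal (σ ^ 3) := by norm_num
  rw [e3]
  rcases le_or_gt σ (ϑ' / R) with hlow | hmid
  · -- LOW levels: Chebyshev with the energy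
    have hcheb := sq_mul_meas_superlevel_le_lintegral hmem.1 hσ
    have hsplit : ENNReal.ofReal (σ ^ 3) = ENNReal.ofReal σ * ENNReal.ofReal (σ ^ 2) := by
      rw [← ENNReal.ofReal_mul hσ.le]; ring_nf
    calc ENNReal.ofReal (σ ^ 3) * volume {x | σ < ‖u t x‖}
        = ENNReal.ofReal σ * (ENNReal.ofReal (σ ^ 2) * volume {x | σ < ‖u t x‖}) := by
          rw [hsplit, mul_assoc]
      _ ≤ ENNReal.ofReal (ϑ' / R) * ENNReal.ofReal E :=
          mul_le_mul' (ENNReal.ofReal_le_ofReal hlow) (hcheb.trans hEt)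
      _ = ENNReal.ofReal (ϑ' / R * E) := (ENNReal.ofReal_mul (by positivity)).symm
      _ ≤ Mtot := le_self_add
  rcases le_or_gt σ (ϑ' / (lam * s)) with hmid' | hhigh
  · -- MIDDLE levels: `r = ϑ'/σ ∈ [λ s, R]`
    set r : ℝ := ϑ' / σ with hr_def
    have hrpos : 0 < r := div_pos hϑ' hσ
    have hr1 : lam * s ≤ r := by
      rw [hr_def, le_div_iff₀ hσ]
      have := (le_div_iff₀ (mul_pos hlam hs)).1 hmid'
      linarith [mul_comm σ (lam * s)]
    have hr2 : r ≤ R := by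
      rw [hr_def, div_le_iff₀ hσ]
      have := (div_lt_iff₀ hR).1 hmid
      linarith [mul_comm R σ]
    have hlev : {x | σ < ‖u t x‖} = {x | ϑ' / r < ‖u t x‖} := by
      have : ϑ' / r = σ := by rw [hr_def]; field_simp
      rw [this]
    rw [hlev]
    calc ENNReal.ofReal (σ ^ 3) * volume {x | ϑ' / r < ‖u t x‖}
        ≤ ENNReal.ofReal (σ ^ 3) * (ENNReal.ofReal (N * (2 * r) ^ 3) * V) :=
          mul_le_mul' le_rfl (hKC r hr1 hr2)
      _ = ENNReal.ofReal (8 * N * ϑ' ^ 3) * V := by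
          rw [← mul_assoc, ← ENNReal.ofReal_mul (pow_nonneg hσ.le 3)]
          congr 2
          have : σ * r = ϑ' := by rw [hr_def]; field_simp
          calc σ ^ 3 * (N * (2 * r) ^ 3) = 8 * N * (σ * r) ^ 3 := by ring
            _ = 8 * N * ϑ' ^ 3 := by rw [this]
      _ ≤ Mtot := le_self_add.trans le_add_self
  · -- HIGH levels: above `B/s` the set is empty; below, compare with the level `ϑ'/(λ s)`
    rcases le_or_gt (B / s) σ with hempty | hBσ
    · have hset : {x | σ < ‖u t x‖} = ∅ :=
        eq_empty_of_forall_notMem fun x hx => (not_lt.2 ((hrate_t x).trans hempty)) hx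
      rw [hset, measure_empty, mul_zero]
      exact zero_le
    · have hsub : {x | σ < ‖u t x‖} ⊆ {x | ϑ' / (lam * s) < ‖u t x‖} :=
        fun x hx => lt_trans hhigh hx
      have hKC' := hKC (lam * s) le_rfl hls.le
      have hσ3 : σ ^ 3 ≤ (B / s) ^ 3 := pow_le_pow_left₀ hσ.le hBσ.le 3
      calc ENNReal.ofReal (σ ^ 3) * volume {x | σ < ‖u t x‖}
          ≤ ENNReal.ofReal ((B / s) ^ 3) * (ENNReal.ofReal (N * (2 * (lam * s)) ^ 3) * V) :=
            mul_le_mul' (ENNReal.ofReal_le_ofReal hσ3) ((measure_mono hsub).trans hKC')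
        _ = ENNReal.ofReal (8 * N * (lam * B) ^ 3) * V := by
            rw [← mul_assoc, ← ENNReal.ofReal_mul (by positivity)]
            congr 2
            field_simp
            ring
        _ ≤ Mtot := le_add_self.trans le_add_self

/-! ### By name: the Lorentz upgrade IS the quarter law -/

open Summit.NavierStokesRegularity.NavierStokesRegularity.Theses.TypeIQuarterGate

/-- **`UniformConcentrationCountTypeI ⟹ LorentzUpgradeTypeI`** (items 23970 ⟹ 24108): the converse of
the landed stub `stub_lorentzCount` (p816300). [folklore] -/
theorem lorentzUpgradeTypeI_of_uniformConcentrationCountTypeI (hU : UniformConcentrationCountTypeI) :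
    LorentzUpgradeTypeI := by
  intro ν T hν hT u p hmax hLH hdec hI
  exact lorentzBound_of_count hν hT hmax.1 hLH hdec hI (hU ν T hν hT u p hmax hLH hdec hI)

/-- **`LorentzUpgradeTypeI ⟺ UniformConcentrationCountTypeI`** (24108 ⟺ 23970). [folklore] -/
theorem lorentzUpgradeTypeI_iff_uniformConcentrationCountTypeI :
    LorentzUpgradeTypeI ↔ UniformConcentrationCountTypeI :=
  ⟨fun hL ν T hν hT u p hmax hLH hdec hI =>
      CountQuarterLaw.stub_lorentzCount ν T hν hT u p hmax hLH hdec hI (hL ν T hν hT u p hmax hLH hdec hI),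
    lorentzUpgradeTypeI_of_uniformConcentrationCountTypeI⟩

/-- **`LorentzUpgradeTypeI ⟺ QuarterLawTypeI`** (24108 ⟺ 23726): the open stub `stub_lorentzUpgrade` of
the registered line `lorentz-upgrade` is EQUIVALENT to the crux — the line is at its fixed point.
[folklore] -/
theorem lorentzUpgradeTypeI_iff_quarterLawTypeI : LorentzUpgradeTypeI ↔ QuarterLawTypeI :=
  lorentzUpgradeTypeI_iff_uniformConcentrationCountTypeI.trans
    CountQuarterLaw.quarterLawTypeI_iff_uniformConcentrationCountTypeI.symm

/-- **`QuarterLawTypeI ⟹ LorentzUpgradeTypeI`** (23726 ⟹ 24108): Leray's quarter rate on a Type-I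
blow-up forces uniformly bounded weak-`L³` slices. [folklore] -/
theorem lorentzUpgradeTypeI_of_quarterLawTypeI (hK : QuarterLawTypeI) : LorentzUpgradeTypeI :=
  lorentzUpgradeTypeI_iff_quarterLawTypeI.2 hK

/-- **The three Type-I statements of the Lorentz line coincide**:
`[LorentzUpgradeTypeI, QuarterLawTypeI, UniformConcentrationCountTypeI].TFAE` (24108, 23726, 23970),
unconditionally. [folklore] -/
theorem lorentz_cruxes_tfae :
    [LorentzUpgradeTypeI, QuarterLawTypeI, UniformConcentrationCountTypeI].TFAE := by
  tfae_have 1 ↔ 2 := lorentzUpgradeTypeI_iff_quarterLawTypeI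
  tfae_have 2 ↔ 3 := CountQuarterLaw.quarterLawTypeI_iff_uniformConcentrationCountTypeI
  tfae_finish

end LorentzOfEnvelope

end Summit.NavierStokesRegularity.NavierStokesRegularity.Theorems
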